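import Summits.KontsevichZagierPeriods.KontsevichZagierPeriods.Theses.IsogenyCertificates
import Literature.NumberTheory.Transcendental.KZCalculus
import Literature.NumberTheory.EllipticCurves.RealLatticePeriod

/-!
# Crux `RealPeriodSectorComplete` (stmt-KontsevichZagierPeriods-5381) — line `period-ratio-branch-cov`

Skeleton of the picked line (lead prover, re-authored from the planner's seven registered stub
signatures; the planner's `Lines/period-ratio-branch-cov.lean` is not readable from this seat).

Composition: for each curve reduce `[{P>0}, a/√P]` to the unbounded component
`[(e,∞), c/√P]` (`stub_unboundedReduction`); uniformise each curve by its real period lattice,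
`℘_Λ(Ω/2) = e`, `value = c·Ω` (`stub_realPeriodLattice`), so value equality reads `Ω' = βΩ`,
`β = c/c' ∈ ℚ`, and `Φ = ℘_{Λ'}(β ℘_Λ⁻¹)` is ONE strictly monotone branch `(e,∞) → (e',∞)`
with `Φ' = β √P'(Φ)/√P` (`stub_uniformizedBranch`; RESHAPED by the lead from the planner's
`stub_periodRatioBranch` + `stub_uniformizedBranch`, which asked for ODE uniqueness);
transcendence (`stub_realLatticeCommensurable`, Schneider 1937 two-`℘`) makes `Λ`, `β⁻¹Λ'`
commensurable, so the graph of `Φ` lies on a divided-isogeny curve `F = 0`, `F ∈ ℚ[x,y]` with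
finite vertical fibres (`stub_dividedIsogenyCurve`); a continuous branch of such a curve is
`ℚ`-semialgebraic (`stub_continuousBranchSemialgebraic`, CAD); hence rule 2) applies once
(`stub_branchMove`), and the two reductions close the chain.
-/

noncomputable section

open MeasureTheory Set Filter
open scoped PeriodPair
open Literature.ModelTheory.ExponentialFields (IsSemialgebraic isSemialgebraic_setOf_eval_eq_zero)
open Literature.NumberTheory.Transcendental
open Literature.NumberTheory.Transcendental.KZ

namespace Summit.KontsevichZagierPeriods.IsogenyCertificates.RealPeriodSectorCompleteLine

open Summit.KontsevichZagierPeriods.KontsevichZagierPeriods.Theses.IsogenyCertificates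
  (RealPeriodSectorComplete)

/-- STUB 1 (unbounded reduction): `[{P>0}, a/√P] ~ [(e,∞), c/√P]`, `e` the largest real root. -/
theorem stub_unboundedReduction : ∀ (A B : ℤ), 4 * A ^ 3 + 27 * B ^ 2 ≠ 0 → ∀ (a : ℚ), 0 < a → ∀ (r : IntegralRep 1), r.domain = {x | 0 < x 0 ^ 3 + (A : ℝ) * x 0 + (B : ℝ)} → EqOn r.integrand (fun x => (a : ℝ) / Real.sqrt (x 0 ^ 3 + (A : ℝ) * x 0 + (B : ℝ))) r.domain → ∃ (e : ℝ) (c : ℚ) (r₁ : IntegralRep 1), e ^ 3 + (A : ℝ) * e + (B : ℝ) = 0 ∧ (∀ x : ℝ, e < x → 0 < x ^ 3 + (A : ℝ) * x + (B : ℝ)) ∧ 0 < c ∧ r₁.domain = {x | e < x 0} ∧ EqOn r₁.integrand (fun x => (c : ℝ) / Real.sqrt (x 0 ^ 3 + (A : ℝ) * x 0 + (B : ℝ))) r₁.domain ∧ Equivalent r r₁ := by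
  sorry

/-- STUB 2 (real period lattice): the real period lattice `Λ` of `y² = P` (invariants
`g₂ = -4A`, `g₃ = -4B`), with `℘_Λ(Ω/2) = e` the largest root and `value [(e,∞), c/√P] = c · Ω`. -/
theorem stub_realPeriodLattice : ∀ (A B : ℤ), 4 * A ^ 3 + 27 * B ^ 2 ≠ 0 → ∀ (e : ℝ), e ^ 3 + (A : ℝ) * e + (B : ℝ) = 0 → (∀ x : ℝ, e < x → 0 < x ^ 3 + (A : ℝ) * x + (B : ℝ)) → ∀ (c : ℚ), 0 < c → ∀ (r₁ : IntegralRep 1), r₁.domain = {x | e < x 0} → EqOn r₁.integrand (fun x => (c : ℝ) / Real.sqrt (x 0 ^ 3 + (A : ℝ) * x 0 + (B : ℝ))) r₁.domain → ∃ L : PeriodPair, L.IsReal ∧ L.g₂ = -4 * (A : ℂ) ∧ L.g₃ = -4 * (B : ℂ) ∧ L.weierstrassPRe (L.minRealPeriod / 2) = e ∧ r₁.value = (c : ℝ) * L.minRealPeriod := by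
  sorry

/-- STUB 3 (uniformized branch): for real lattices with `Ω' = β Ω` the map
`Φ = ℘_{Λ'} ∘ (β ·) ∘ ℘_Λ⁻¹` is a strictly increasing bijection `(e,∞) → (e',∞)` solving
`Φ' = β √P'(Φ)/√P`. -/
theorem stub_uniformizedBranch : ∀ (A B A' B' : ℤ) (L L' : PeriodPair), L.IsReal → L'.IsReal → L.g₂ = -4 * (A : ℂ) → L.g₃ = -4 * (B : ℂ) → L'.g₂ = -4 * (A' : ℂ) → L'.g₃ = -4 * (B' : ℂ) → ∀ (β : ℚ), 0 < β → L'.minRealPeriod = (β : ℝ) * L.minRealPeriod → ∃ Φ : ℝ → ℝ, StrictMonoOn Φ (Ioi (L.weierstrassPRe (L.minRealPeriod / 2))) ∧ Φ '' Ioi (L.weierstrassPRe (L.minRealPeriod / 2)) = Ioi (L'.weierstrassPRe (L'.minRealPeriod / 2)) ∧ (∀ x : ℝ, L.weierstrassPRe (L.minRealPeriod / 2) < x → HasDerivAt Φ ((β : ℝ) * Real.sqrt (Φ x ^ 3 + (A' : ℝ) * Φ x + (B' : ℝ)) / Real.sqrt (x ^ 3 + (A : ℝ) * x + (B : ℝ)))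 x) ∧ ∀ x : ℝ, L.weierstrassPRe (L.minRealPeriod / 2) < x → ∃ z : ℝ, 0 < z ∧ z < L.minRealPeriod / 2 ∧ ℘[L] (z : ℂ) = (x : ℂ) ∧ ℘[L'] ((β : ℂ) * (z : ℂ)) = (Φ x : ℂ) := by
  sorry

/-- STUB 4 (transcendence, Schneider 1937): two lattices with algebraic invariants sharing a
non-zero vector are commensurable. -/
theorem stub_realLatticeCommensurable : ∀ (L₁ L₂ : PeriodPair), IsAlgebraic ℚ L₁.g₂ → IsAlgebraic ℚ L₁.g₃ → IsAlgebraic ℚ L₂.g₂ → IsAlgebraic ℚ L₂.g₃ → (∃ ℓ : ℂ, ℓ ≠ 0 ∧ ℓ ∈ L₁.lattice ∧ ℓ ∈ L₂.lattice) → ∃ m : ℕ, 0 < m ∧ ∀ z ∈ L₁.lattice, (m : ℂ) * z ∈ L₂.lattice := by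
  sorry

/-- STUB 5 (divided-isogeny curve): the graph of the uniformized branch lies on an algebraic
curve over `ℚ` with finite vertical fibres. -/
theorem stub_dividedIsogenyCurve : (∀ (L₁ L₂ : PeriodPair), IsAlgebraic ℚ L₁.g₂ → IsAlgebraic ℚ L₁.g₃ → IsAlgebraic ℚ L₂.g₂ → IsAlgebraic ℚ L₂.g₃ → (∃ ℓ : ℂ, ℓ ≠ 0 ∧ ℓ ∈ L₁.lattice ∧ ℓ ∈ L₂.lattice) → ∃ m : ℕ, 0 < m ∧ ∀ z ∈ L₁.lattice, (m : ℂ) * z ∈ L₂.lattice) → ∀ (A B A' B' : ℤ) (e : ℝ) (β : ℚ), 0 < β → ∀ (Φ : ℝ → ℝ) (L L' : PeriodPair), L.IsReal → L'.IsReal → L.g₂ = -4 * (A : ℂ) → L.g₃ = -4 * (B : ℂ) → L'.g₂ = -4 * (A' : ℂ) → L'.g₃ = -4 * (B' : ℂ) → L'.minRealPeriod = (β : ℝ) * L.minRealPeriod → (∀ x : ℝ, e < x → ∃ z : ℝ, 0 < z ∧ z < L.minRealPeriod / 2 ∧ ℘[L] (z : ℂ) = (x : ℂ) ∧ ℘[L']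 ((β : ℂ) * (z : ℂ)) = (Φ x : ℂ)) → ContinuousOn Φ (Ioi e) → ∃ F : MvPolynomial (Fin 2) ℚ, (∀ x : ℝ, e < x → {y : ℝ | MvPolynomial.aeval (![x, y] : Fin 2 → ℝ) F = 0}.Finite) ∧ ∀ x : ℝ, e < x → MvPolynomial.aeval (![x, Φ x] : Fin 2 → ℝ) F = 0 := by
  sorry

/-- STUB 6 (CAD): a continuous branch of a semialgebraic set with finite vertical fibres is
semialgebraic. -/
theorem stub_continuousBranchSemialgebraic : ∀ (e : ℝ) (Φ : ℝ → ℝ) (Z : Set (Fin 2 → ℝ)), IsSemialgebraic ℚ {p : Fin 1 → ℝ | e < p 0} → IsSemialgebraic ℚ Z → (∀ x : ℝ, e < x → {y : ℝ | (![x, y] : Fin 2 → ℝ) ∈ Z}.Finite) → ContinuousOn Φ (Ioi e) → (∀ x : ℝ, e < x → (![x, Φ x] : Fin 2 → ℝ) ∈ Z) → IsSemialgebraic ℚ {p : Fin 2 → ℝ | e < p 0 ∧ p 1 = Φ (p 0)} := by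
  sorry

/-- STUB 7 (the one rule-2 move along the branch). -/
theorem stub_branchMove : ∀ (A B A' B' : ℤ) (e e' : ℝ), (∀ x : ℝ, e < x → 0 < x ^ 3 + (A : ℝ) * x + (B : ℝ)) → (∀ x : ℝ, e' < x → 0 < x ^ 3 + (A' : ℝ) * x + (B' : ℝ)) → ∀ (β c c' : ℚ), 0 < β → c = β * c' → ∀ (Φ : ℝ → ℝ), StrictMonoOn Φ (Ioi e) → Φ '' Ioi e = Ioi e' → (∀ x : ℝ, e < x → HasDerivAt Φ ((β : ℝ) * Real.sqrt (Φ x ^ 3 + (A' : ℝ) * Φ x + (B' : ℝ)) / Real.sqrt (x ^ 3 + (A : ℝ) * x + (B : ℝ))) x) → IsSemialgebraic ℚ {p : Fin 2 → ℝ | e < p 0 ∧ p 1 = Φ (p 0)} → ∀ (r₁ r₁' : IntegralRep 1), r₁.domain = {x | e < x 0} → EqOn r₁.integrand (fun x => (c : ℝ) / Real.sqrt (x 0 ^ 3 + (A : ℝ) * x 0 + (B : ℝ))) r₁.domain → r₁'.domain = {x | e' < x 0} → EqOn r₁'.integrand (fun x => (c' : ℝ) / Real.sqrt (x 0 ^ 3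 + (A' : ℝ) * x 0 + (B' : ℝ))) r₁'.domain → KZ.of r₁ - KZ.of r₁' ∈ changeOfVariablesRel := by
  sorry

/-- **The line closes the crux**: composition of the seven stubs. -/
theorem RealPeriodSectorComplete_of : RealPeriodSectorComplete := by
  intro A B A' B' hΔ hΔ' a b ha hb r r' hd hi hd' hi' hv
  -- reduce both sides to the unbounded components
  obtain ⟨e, c, r₁, he, hpos, hc, hd₁, hi₁, hE⟩ := stub_unboundedReduction A B hΔ a ha r hd hi
  obtain ⟨e', c', r₁', he', hpos', hc', hd₁', hi₁', hE'⟩ :=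
    stub_unboundedReduction A' B' hΔ' b hb r' hd' hi'
  -- value equality transfers along the (sound) reductions
  have hv₁ : r₁.value = r₁'.value := by
    rw [← Equivalent.value_eq_holds hE, ← Equivalent.value_eq_holds hE', hv]
  -- the two real period lattices, their largest roots and real periods
  obtain ⟨L, hL, hg₂, hg₃, heL, hval⟩ := stub_realPeriodLattice A B hΔ e he hpos c hc r₁ hd₁ hi₁
  obtain ⟨L', hL', hg₂', hg₃', heL', hval'⟩ :=
    stub_realPeriodLattice A' B' hΔ' e' he' hpos' c' hc' r₁' hd₁' hi₁'
  set β : ℚ := c / c' with hβ_def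
  have hβ : 0 < β := div_pos hc hc'
  have hcc' : c = β * c' := by rw [hβ_def, div_mul_cancel₀ c hc'.ne']
  have hper : L'.minRealPeriod = (β : ℝ) * L.minRealPeriod := by
    have h1 : (c : ℝ) * L.minRealPeriod = (c' : ℝ) * L'.minRealPeriod := by rw [← hval, ← hval', hv₁]
    have hc'0 : (c' : ℝ) ≠ 0 := by exact_mod_cast hc'.ne'
    rw [hβ_def]
    push_cast
    field_simp
    linarith
  -- the branch `Φ = ℘_{Λ'} ∘ (β ·) ∘ ℘_Λ⁻¹`
  obtain ⟨Φ, hmono, himg, hderiv, hbranch⟩ := stub_uniformizedBranch A B A' B' L L' hL hL' hg₂ hg₃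
    hg₂' hg₃' β hβ hper
  rw [heL] at hmono himg hderiv hbranch
  rw [heL'] at himg
  have hcont : ContinuousOn Φ (Ioi e) := fun x hx =>
    (hderiv x hx).continuousAt.continuousWithinAt
  -- the divided-isogeny curve through the graph (transcendence enters here)
  obtain ⟨F, hfin, hF⟩ := stub_dividedIsogenyCurve stub_realLatticeCommensurable A B A' B' e β hβ
    Φ L L' hL hL' hg₂ hg₃ hg₂' hg₃' hper hbranch hcont
  -- the graph of the branch is semialgebraic
  have hdomSA : IsSemialgebraic ℚ {p : Fin 1 → ℝ | e < p 0} := by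
    have h := r₁.isSemialgebraic_domain
    rwa [hd₁] at h
  have hZ : IsSemialgebraic ℚ {p : Fin 2 → ℝ | MvPolynomial.aeval p F = 0} :=
    isSemialgebraic_setOf_eval_eq_zero (R := ℝ) F
  have hgraph : IsSemialgebraic ℚ {p : Fin 2 → ℝ | e < p 0 ∧ p 1 = Φ (p 0)} :=
    stub_continuousBranchSemialgebraic e Φ {p : Fin 2 → ℝ | MvPolynomial.aeval p F = 0} hdomSA hZ
      (fun x hx => hfin x hx) hcont (fun x hx => hF x hx)
  -- one change of variables
  have hmove := stub_branchMove A B A' B' e e' hpos hpos' β c c' hβ hcc' Φ hmono himg hderiv hgraph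
    r₁ r₁' hd₁ hi₁ hd₁' hi₁'
  have h₁₁' : Equivalent r₁ r₁' := changeOfVariablesRel_subset_relations hmove
  exact (hE.trans h₁₁').trans hE'.symm

end Summit.KontsevichZagierPeriods.IsogenyCertificates.RealPeriodSectorCompleteLine

end
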